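import Literature.AlgebraicGeometry.ShimuraVarieties.UnitaryShimuraCurveHeckeDescent
import Literature.AlgebraicGeometry.Motives.BaseChangeComplexPointsAlong
import Literature.AlgebraicGeometry.Motives.ComplexAutGaloisDescentOfDense
import Literature.AlgebraicGeometry.HodgeTheory.QuasiProjectiveSeparatedOfField
import HarnessLib

/-!
# A `ℂ`-morphism from the complex fibre of the canonical model of the unitary Shimura CURVE to a separated `ℚ`-scheme,
# whose point map obeys Shimura reciprocity at the CM points for `Aut(ℂ∕E)`, descends to the slice field `E ⊇ L`
# ([Milne 2005] Prop. 13.1 + Lemma 13.5, the argument of Thm. 13.6∕13.7; [Deligne 1979] 2.2.6)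

Topic `AlgebraicGeometry/ShimuraVarieties`, namespace `…ShimuraVarieties.UnitaryCanonicalModel` (the object of ★ `UnitaryShimuraCurveRecord`:
the record system `RecordSystemGS L J⋆ τ K₀` of the canonical model of `Sh(U(J⋆), 𝔻)` over the CM field `L` along `τ`).  THEOREMS ONLY
(no definition, no instance, no notation, no named fact, no `sorry`).  Cell `hodgecm-mathlib` (D-0151), programme P6, door (E) of the crux
`hLiu418` (stmt-HodgeConjecture-24832): the organ E5 «descent to the slice field» of the E-line `Cruxes/HLiu418/Lines/F0_P6a_PELWitnessE.lean`
(`stub_E5`, by value).  HONEST LABEL: HC_CM is proved only modulo the 2 remaining named inputs (hLiu418 24832, h413 24833) until rung 0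
closes; this file is count-neutral.

SETTING.  `S : RecordSystemGS L J⋆ τ K₀`, a small level `K`, a SLICE FIELD `E ⊇ L` with a complex embedding `τE` extending `τ`, a `ℚ`-scheme
`M` SEPARATED over `ℚ` (in the application: the Siegel fine moduli scheme) and a map `f : Sh_K(ℂ) → M(ℂ)` satisfying SHIMURA RECIPROCITY AT
THE DIAGONAL CM PAIRS for `Aut(ℂ∕τE E)`: `σ|_ℚ • f [τw, aK] = f [τw, d·aK]` for every `σ ∈ Aut(ℂ∕τE E)` with Artin correspondent `s` and every
twist `d` of the CM pair of `w ∈ L²` by the reciprocity factor of `s` ([Milne2005ShimuraVarieties] (62) p. 114 on both sides).  THEN: **if SOME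
`ℂ`-morphism `ψ : (M_K)_τ → M_ℂ` acts on complex points as `f ∘ pts`, there is an `E`-morphism `ε : M_K ⊗_L E → M ⊗_ℚ E` acting on complex
points (along `τE`) as `f ∘ pts ∘ pr₁`** (`RecordSystemGS.exists_sliceDescent_of_complex`).  PROOF (the printed one, [Milne2005ShimuraVarieties]
p. 118 L29–41 ∕ Thm. 13.7, token for token along ★ `UnitaryShimuraCurveEmbeddingDescent` with the TARGET record replaced by `(M, f)`): §1 `ψ`
sends the point `(P, 1)` of the complex fibre to `(f (pts P), 1)`; §2 for `σ ∈ Aut(ℂ∕τE E)` the conjugate `(1 × Spec σ|_L) ≫ ψ ≫ (1 × Spec σ|_ℚ⁻¹)`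
agrees with `ψ` on the Hecke orbit of a special point `[τw]` (record `recip` at `σ|_L⁻¹`, reciprocity of `f` at `σ`, `σ⁻¹`); §3 hence
everywhere (density ★ `ShimuraSetGS.eq_of_forall_mk_eq` = Lemma 13.5; ★ `SchemeOver.hom_ext_of_forall_algPoints`; `𝔻 = ∅` vacuous); §4 along the
transitivity isomorphisms `(M_K ⊗_L E) ⊗_{τE} ℂ ≅ (M_K)_τ`, `(M ⊗_ℚ E) ⊗_{τE} ℂ ≅ M_ℂ` (★ `Motives.exists_iso_baseChangeHom_baseChange`) this is
`Aut(ℂ∕τE E)`-equivariance of `gX ≫ ψ ≫ gM⁻¹`, which descends to `E` (★ `GaloisDescent.existsUnique_map_eq_complex`, Prop. 13.1, `E` countable).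

## References
* [Milne2005ShimuraVarieties] J. S. Milne, *Introduction to Shimura varieties* (2005; held rev. 2017 `paper:url-b0e8e4ca1c12`), §13:
  Prop. 13.1 p. 117, Lemma 13.5 and Thm. 13.6 p. 118, Thm. 13.7 ∕ Rem. 13.8 p. 119; Def. 12.8 (62) p. 114.
* [Deligne1979ShimuraVarieties] P. Deligne, *Variétés de Shimura* (1979), 2.2.4–2.2.6, Cor. 2.7.21.
* [GortzWedhorn2020] U. Görtz, T. Wedhorn, *Algebraic Geometry I* (2nd ed. 2020), Prop. 4.16, §(4.7), §(14.20).
-/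

set_option autoImplicit false

noncomputable section

open Function MulAction Topology NumberField IsDedekindDomain CategoryTheory CategoryTheory.Limits Matrix
  AlgebraicGeometry Cardinal
open scoped Matrix ComplexOrder
open Literature.AlgebraicGeometry.Motives Literature.NumberTheory.Automorphic Literature.NumberTheory.Automorphic.UnitaryGroup
open Literature.NumberTheory.Automorphic.Liu2021.AppendixC (C5.OpenCompactSubgroup C5.SmallLevel)
open Literature.AlgebraicGeometry.Motives.AbelianVariety (bcSpec bcFunctor specAut)

namespace Literature.AlgebraicGeometry.ShimuraVarieties.UnitaryCanonicalModel

variable {L : Type} [Field L] [NumberField L] [IsCMField L] {Jstar : Matrix (Fin 2) (Fin 2) L} {τ : L →+* ℂ}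
  {K₀ : C5.OpenCompactSubgroup ↥(finAdelic (↥(maximalRealSubfield L)) L (IsCMField.complexConj L) 2 Jstar)}

/-! ### §0. Bookkeeping on `Spec` of Galois automorphisms read through a restriction of scalars -/

omit [NumberField L] [IsCMField L] in
/-- Two automorphisms of `ℂ` over possibly different base fields with the same underlying map have the same `Spec`
(`specAut σ = Spec σ` only sees the ring map). [folklore] -/
private theorem specAut_eq_of_forall_eq {k k' : Type} [Field k] [Field k'] [Algebra k ℂ] [Algebra k' ℂ]
    (σ : ℂ ≃ₐ[k] ℂ) (σ' : ℂ ≃ₐ[k'] ℂ) (h : ∀ z, σ z = σ' z) : specAut ℂ σ = specAut ℂ σ' := by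
  have hh : (σ : ℂ →+* ℂ) = (σ' : ℂ →+* ℂ) := RingHom.ext h
  change Spec.map (CommRingCat.ofHom (σ : ℂ →+* ℂ)) = Spec.map (CommRingCat.ofHom (σ' : ℂ →+* ℂ))
  rw [hh]

omit [NumberField L] [IsCMField L] in
/-- … and their inverses have the same underlying map (so the same `RingEquiv`, the currency of ★ `IsArtinCorrespondent`). [folklore] -/
private theorem inv_apply_eq_of_forall_eq {k k' : Type} [Field k] [Field k'] [Algebra k ℂ] [Algebra k' ℂ]
    (σ : ℂ ≃ₐ[k] ℂ) (σ' : ℂ ≃ₐ[k'] ℂ) (h : ∀ z, σ z = σ' z) (z : ℂ) : σ⁻¹ z = σ'⁻¹ z := by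
  apply σ.injective
  change σ (σ.symm z) = σ (σ'.symm z)
  rw [AlgEquiv.apply_symm_apply, h, AlgEquiv.apply_symm_apply]

/-! ### §1. The complex morphism on the points `(P, 1)`: source over `L` (along `τ`), target over `ℚ` -/

section SliceDescent

variable (S : RecordSystemGS L Jstar τ K₀) (K : C5.SmallLevel K₀) (M : SchemeOver ℚ)
  (f : ShimuraSetGS L Jstar τ K.1.1 → ComplexPoints M)
  {E : Type} [Field E] [NumberField E] [Algebra L E] (τE : E →+* ℂ)
  (hf : letI : Algebra E ℂ := τE.toAlgebra
    ∀ (σ : ℂ ≃ₐ[E] ℂ) (s : (FiniteAdeleRing (𝓞 L) L)ˣ), IsArtinCorrespondent L τ s σ.toRingEquiv →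
      ∀ (w : Fin 2 → L) (hw : (fun i => τ (w i)) ∈ negCone (Jstar.map τ))
        (d : ↥(finAdelic (↥(maximalRealSubfield L)) L (IsCMField.complexConj L) 2 Jstar)),
        IsDiagTwistGS L Jstar w (recipFactor L s) d →
        ∀ a : ↥(finAdelic (↥(maximalRealSubfield L)) L (IsCMField.complexConj L) 2 Jstar),
          (σ.restrictScalars ℚ) • f (ShimuraSetGS.mk L Jstar τ K.1.1 (fun i => τ (w i)) hw a) =
            f (ShimuraSetGS.mk L Jstar τ K.1.1 (fun i => τ (w i)) hw (d * a)))
  (ψ : (Motives.baseChangeHom τ).obj (S.M.obj K) ⟶ (Motives.baseChange ℚ ℂ).obj M)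
  (hψ : letI : Algebra L ℂ := τ.toAlgebra
    ∀ P : ComplexPoints (S.M.obj K),
      (AlgPoints.map ψ (AlgPoints.baseChangeEquiv τ (S.M.obj K) P)).left ≫ Motives.baseChangeHomFst (algebraMap ℚ ℂ) M =
        (f (S.pts K P)).left)
  (t : letI : Algebra L ℂ := τ.toAlgebra; GaloisDescent.bc ℂ (S.M.obj K) ⟶ GaloisDescent.bc ℂ M)
  (ht : t = ψ.left)

include hψ ht in
/-- **`ψ` acts as `f ∘ pts` on the points `(P, 1)` of the complex fibre**: `(P, 1) ≫ ψ = (f (pts P), 1)` as morphisms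
`Spec ℂ → M ×_ℚ Spec ℂ`, where `t` is `ψ.left` read on the fibre products (`ht : t = ψ.left`, as in ★ `UnitaryShimuraCurveHeckeDescent`; the
hypothesis gives the first projection, the second is the identity of `Spec ℂ` since `ψ` is a morphism over `ℂ`). [cite: Milne2005ShimuraVarieties, §13 Prop. 13.1 p. 117 («the actions of Aut(Ω/k) on V(Ω)»)] -/
theorem RecordSystemGS.lift_comp_sliceComplex_left (P : letI : Algebra L ℂ := τ.toAlgebra; ComplexPoints (S.M.obj K)) :
    letI : Algebra L ℂ := τ.toAlgebra
    pullback.lift P.toSpecHom (𝟙 (Spec (.of ℂ))) (toSpecHom_comp_hom_eq (τ := τ) (S.M.obj K) P) ≫ t =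
      pullback.lift (f (S.pts K P)).toSpecHom (𝟙 (Spec (.of ℂ)))
        (toSpecHom_comp_hom_eq (τ := algebraMap ℚ ℂ) M (f (S.pts K P))) := by
  letI : Algebra L ℂ := τ.toAlgebra
  have h : (AlgPoints.baseChangeEquiv τ (S.M.obj K) P).left ≫ ψ.left =
      (AlgPoints.baseChangeEquiv (algebraMap ℚ ℂ) M (f (S.pts K P))).left := by
    apply pullback.hom_ext
    · have h1 := hψ P
      rw [AlgPoints.map, Over.comp_left, Category.assoc] at h1
      exact h1.trans (AlgPoints.baseChangeEquiv_apply_left_comp_fst (algebraMap ℚ ℂ) M (f (S.pts K P))).symm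
    · have h1 := AlgPoints.baseChangeEquiv_apply_left_comp_snd τ (S.M.obj K) P
      have h2 := AlgPoints.baseChangeEquiv_apply_left_comp_snd (algebraMap ℚ ℂ) M (f (S.pts K P))
      have hw : ψ.left ≫ ((Motives.baseChange ℚ ℂ).obj M).hom = ((Motives.baseChangeHom τ).obj (S.M.obj K)).hom := Over.w ψ
      exact (Category.assoc _ _ _).trans
        ((congrArg ((AlgPoints.baseChangeEquiv τ (S.M.obj K) P).left ≫ ·) hw).trans (h1.trans h2.symm))
  rwa [← lift_eq_baseChangeEquiv_left, ← lift_eq_baseChangeEquiv_left, ← ht] at h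

/-! ### §2. The conjugate of `ψ` by `σ ∈ Aut(ℂ∕τE E)` agrees with `ψ` on the Hecke orbit of a special point -/

set_option maxHeartbeats 800000 in -- large adelic ∕ Shimura-set terms: instance-heavy statements (as ★ `UnitaryShimuraCurveHeckeDescent`)
omit [Algebra L E] in include hψ ht hf in
/-- **The conjugate `σ|_L⁻¹(ψ)` agrees with `ψ` on the Hecke orbit of a special point** (the square of [Milne2005ShimuraVarieties]
p. 118 L33–39, SOURCE the curve record over `L`, TARGET a `ℚ`-scheme): for `σ ∈ Aut(ℂ∕τE E)`, `σL ∈ Aut(ℂ∕τL)` with the same underlying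
map, Artin correspondents `s`, `s'` of `σ`, `σ⁻¹`, twists `d`, `d'` at `x₀ = [τ w]`, and ANY `T'` with underlying morphism
`(1 × Spec σL) ≫ ψ ≫ (1 × Spec σ|_ℚ⁻¹)`: `T'(P) = ψ(P)` for `P = pts⁻¹[x₀, aK]` — the record՚s `recip` at `σL⁻¹` moves `P` to
`pts⁻¹[x₀, d'aK]`, `f`՚s reciprocity at `σ` and `σ⁻¹` moves `f [x₀, d'aK]` back to `f [x₀, aK]`.
[cite: Milne2005ShimuraVarieties, Thm. 13.6 p. 118 L29–39; Def. 12.8 (62) p. 114; Rem. 13.8 p. 119] -/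
theorem RecordSystemGS.map_conj_eq_sliceComplex_of_recip
    (σ : letI : Algebra E ℂ := τE.toAlgebra; ℂ ≃ₐ[E] ℂ) (σL : letI : Algebra L ℂ := τ.toAlgebra; ℂ ≃ₐ[L] ℂ) (hσL : ∀ z, σL z = σ z)
    {w : Fin 2 → L} (hw : (fun i => τ (w i)) ∈ negCone (Jstar.map τ)) {s s' : (FiniteAdeleRing (𝓞 L) L)ˣ}
    (hs : letI : Algebra E ℂ := τE.toAlgebra; IsArtinCorrespondent L τ s σ.toRingEquiv)
    (hs' : letI : Algebra E ℂ := τE.toAlgebra; IsArtinCorrespondent L τ s' σ⁻¹.toRingEquiv)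
    {d d' : ↥(finAdelic (↥(maximalRealSubfield L)) L (IsCMField.complexConj L) 2 Jstar)}
    (hd : IsDiagTwistGS L Jstar w (recipFactor L s) d) (hd' : IsDiagTwistGS L Jstar w (recipFactor L s') d')
    (T' : (Motives.baseChangeHom τ).obj (S.M.obj K) ⟶ (Motives.baseChange ℚ ℂ).obj M)
    (hT' : letI : Algebra L ℂ := τ.toAlgebra; letI : Algebra E ℂ := τE.toAlgebra
      GaloisDescent.gal ℂ (S.M.obj K) σL⁻¹ ≫ t ≫ GaloisDescent.gal ℂ M (σ.restrictScalars ℚ) = T'.left)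
    (a : ↥(finAdelic (↥(maximalRealSubfield L)) L (IsCMField.complexConj L) 2 Jstar)) :
    letI : Algebra L ℂ := τ.toAlgebra
    AlgPoints.map T' (AlgPoints.baseChangeEquiv τ (S.M.obj K)
        ((S.pts K).symm (ShimuraSetGS.mk L Jstar τ K.1.1 (fun i => τ (w i)) hw a))) =
      AlgPoints.map ψ (AlgPoints.baseChangeEquiv τ (S.M.obj K)
        ((S.pts K).symm (ShimuraSetGS.mk L Jstar τ K.1.1 (fun i => τ (w i)) hw a))) := by
  letI iL : Algebra L ℂ := τ.toAlgebra; letI iE : Algebra E ℂ := τE.toAlgebra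
  have hspec : specAut ℂ σL = specAut ℂ (σ.restrictScalars ℚ) := specAut_eq_of_forall_eq σL _ fun z => hσL z
  have hinv : (σ⁻¹.restrictScalars ℚ : ℂ ≃ₐ[ℚ] ℂ) = (σ.restrictScalars ℚ)⁻¹ := AlgEquiv.ext fun _ => rfl
  have hsL' : IsArtinCorrespondent L τ s' σL⁻¹.toRingEquiv := by
    rw [show σL⁻¹.toRingEquiv = σ⁻¹.toRingEquiv from RingEquiv.ext (inv_apply_eq_of_forall_eq σL σ hσL)]; exact hs'
  have rS : ∀ b, σL⁻¹ • (S.pts K).symm (ShimuraSetGS.mk L Jstar τ K.1.1 (fun i => τ (w i)) hw b) =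
      (S.pts K).symm (ShimuraSetGS.mk L Jstar τ K.1.1 (fun i => τ (w i)) hw (d' * b)) :=
    S.recip K σL⁻¹ s' hsL' w hw d' hd'
  have rTσ : ∀ b, (σ.restrictScalars ℚ) • f (ShimuraSetGS.mk L Jstar τ K.1.1 (fun i => τ (w i)) hw b) =
      f (ShimuraSetGS.mk L Jstar τ K.1.1 (fun i => τ (w i)) hw (d * b)) :=
    hf σ s hs w hw d hd
  have rT : ∀ b, (σ.restrictScalars ℚ)⁻¹ • f (ShimuraSetGS.mk L Jstar τ K.1.1 (fun i => τ (w i)) hw b) =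
      f (ShimuraSetGS.mk L Jstar τ K.1.1 (fun i => τ (w i)) hw (d' * b)) := by
    intro b
    rw [← hinv]; exact hf σ⁻¹ s' hs' w hw d' hd' b
  have FT : ∀ b, pullback.lift ((S.pts K).symm (ShimuraSetGS.mk L Jstar τ K.1.1 (fun i => τ (w i)) hw b)).toSpecHom
        (𝟙 (Spec (.of ℂ))) (toSpecHom_comp_hom_eq (τ := τ) (S.M.obj K) _) ≫ t =
      pullback.lift (f (ShimuraSetGS.mk L Jstar τ K.1.1 (fun i => τ (w i)) hw b)).toSpecHom (𝟙 (Spec (.of ℂ)))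
        (toSpecHom_comp_hom_eq (τ := algebraMap ℚ ℂ) M _) := by
    intro b
    have h := S.lift_comp_sliceComplex_left K M f ψ hψ t ht
      ((S.pts K).symm (ShimuraSetGS.mk L Jstar τ K.1.1 (fun i => τ (w i)) hw b))
    rwa [Homeomorph.apply_symm_apply] at h
  set P := (S.pts K).symm (ShimuraSetGS.mk L Jstar τ K.1.1 (fun i => τ (w i)) hw a) with hP
  apply Over.OverMorphism.ext
  change (AlgPoints.baseChangeEquiv τ (S.M.obj K) P).left ≫ T'.left =
    (AlgPoints.baseChangeEquiv τ (S.M.obj K) P).left ≫ ψ.left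
  rw [← lift_eq_baseChangeEquiv_left, ← hT', ← ht]
  change pullback.lift P.toSpecHom (𝟙 (Spec (.of ℂ))) (toSpecHom_comp_hom_eq (τ := τ) (S.M.obj K) P) ≫
      (GaloisDescent.gal ℂ (S.M.obj K) σL⁻¹ ≫ t ≫ GaloisDescent.gal ℂ M (σ.restrictScalars ℚ)) =
    pullback.lift P.toSpecHom (𝟙 (Spec (.of ℂ))) (toSpecHom_comp_hom_eq (τ := τ) (S.M.obj K) P) ≫ t
  have step1 : pullback.lift P.toSpecHom (𝟙 (Spec (.of ℂ))) (toSpecHom_comp_hom_eq (τ := τ) (S.M.obj K) P) ≫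
      GaloisDescent.gal ℂ (S.M.obj K) σL⁻¹ =
      specAut ℂ σL ≫ pullback.lift (σL⁻¹ • P).toSpecHom (𝟙 (Spec (.of ℂ)))
        (toSpecHom_comp_hom_eq (τ := τ) (S.M.obj K) (σL⁻¹ • P)) := by
    have h := lift_comp_gal (τ := τ) (S.M.obj K) σL⁻¹ P
    rwa [inv_inv] at h
  have step3 : ∀ Q : ComplexPoints M,
      pullback.lift Q.toSpecHom (𝟙 (Spec (.of ℂ))) (toSpecHom_comp_hom_eq (τ := algebraMap ℚ ℂ) M Q) ≫
          GaloisDescent.gal ℂ M (σ.restrictScalars ℚ) =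
        specAut ℂ (σ.restrictScalars ℚ)⁻¹ ≫ pullback.lift ((σ.restrictScalars ℚ) • Q).toSpecHom (𝟙 (Spec (.of ℂ)))
          (toSpecHom_comp_hom_eq (τ := algebraMap ℚ ℂ) M ((σ.restrictScalars ℚ) • Q)) :=
    fun Q => lift_comp_gal (τ := algebraMap ℚ ℂ) M (σ.restrictScalars ℚ) Q
  rw [← Category.assoc, step1, Category.assoc, hP, rS a, ← Category.assoc (pullback.lift _ _ _), FT (d' * a),
    step3, rTσ, ← Category.assoc, hspec, AbelianVariety.specAut_comp_specAut_symm, Category.id_comp, FT a]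
  -- the two points of `M(ℂ)` coincide: `f [x₀, d d' a K] = f [x₀, a K]`
  have hfix : f (ShimuraSetGS.mk L Jstar τ K.1.1 (fun i => τ (w i)) hw (d * (d' * a))) =
      f (ShimuraSetGS.mk L Jstar τ K.1.1 (fun i => τ (w i)) hw a) := by
    rw [← rTσ, ← rT, smul_inv_smul]
  rw [hfix]

/-! ### §3. `σ|_L(ψ) = ψ` for every `σ ∈ Aut(ℂ∕τE E)` -/

set_option maxHeartbeats 400000 in -- large adelic ∕ Shimura-set terms: instance-heavy statements (as ★ `UnitaryShimuraCurveHeckeDescent`)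
omit [Algebra L E] in include hψ ht hf in
/-- **`(1 × Spec σL⁻¹) ≫ ψ = ψ ≫ (1 × Spec σ|_ℚ⁻¹)`** ([Milne2005ShimuraVarieties] Thm. 13.6, proof, p. 118 L29–41, target a separated
`ℚ`-scheme): `ψ : (M_K)_τ → M_ℂ` acting as `f ∘ pts` on complex points, `f` obeying Shimura reciprocity at the diagonal CM pairs for
`Aut(ℂ∕τE E)`, intertwines the Galois automorphisms of `σL = σ|_L` (source) and `σ|_ℚ` (target).  The conjugate is a `ℂ`-morphism `T'`;
`ℂ`-morphisms from the reduced complex curve to the separated `M_ℂ` are determined by their complex points (★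
`SchemeOver.hom_ext_of_forall_algPoints`), read through `e : (M_K)_τ(ℂ) ≃ₜ Sh_K(ℂ)`; if `𝔻 ≠ ∅`: a special point `[τw]` (★
`exists_embedding_mem_negCone`), agreement on its Hecke orbit (`map_conj_eq_sliceComplex_of_recip`), density (★ `ShimuraSetGS.eq_of_forall_mk_eq`,
Lemma 13.5); if `𝔻 = ∅`: vacuous. [cite: Milne2005ShimuraVarieties, Thm. 13.6 p. 118 L29–41; Lemma 13.5 p. 118; Prop. 13.1 p. 117] -/
theorem RecordSystemGS.gal_comp_sliceComplex [IsSeparated M.hom] (hJ : (Jstar.map (IsCMField.complexConj L))ᵀ = Jstar)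
    (hdet : IsUnit Jstar.det) (σ : letI : Algebra E ℂ := τE.toAlgebra; ℂ ≃ₐ[E] ℂ) (σL : letI : Algebra L ℂ := τ.toAlgebra; ℂ ≃ₐ[L] ℂ)
    (hσL : ∀ z, σL z = σ z)
    (e : letI : Algebra L ℂ := τ.toAlgebra
      ComplexPoints ((Motives.baseChangeHom τ).obj (S.M.obj K)) ≃ₜ ShimuraSetGS L Jstar τ K.1.1)
    (he : letI : Algebra L ℂ := τ.toAlgebra
      ∀ (v : Fin 2 → ℂ) (hv : v ∈ negCone (Jstar.map τ))
        (b : ↥(finAdelic (↥(maximalRealSubfield L)) L (IsCMField.complexConj L) 2 Jstar)),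
        e.symm (ShimuraSetGS.mk L Jstar τ K.1.1 v hv b) =
          AlgPoints.baseChangeEquiv τ (S.M.obj K) ((S.pts K).symm (ShimuraSetGS.mk L Jstar τ K.1.1 v hv b))) :
    letI : Algebra L ℂ := τ.toAlgebra; letI : Algebra E ℂ := τE.toAlgebra
    GaloisDescent.gal ℂ (S.M.obj K) σL ≫ t = t ≫ GaloisDescent.gal ℂ M (σ.restrictScalars ℚ) := by
  letI iL : Algebra L ℂ := τ.toAlgebra; letI iE : Algebra E ℂ := τE.toAlgebra
  haveI : SmoothOfRelativeDimension 1 ((Motives.baseChangeHom τ).obj (S.M.obj K)).hom := S.smooth_complexFibre K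
  haveI : Smooth ((Motives.baseChangeHom τ).obj (S.M.obj K)).hom := SmoothOfRelativeDimension.smooth 1 _
  haveI : IsReduced ((Motives.baseChangeHom τ).obj (S.M.obj K)).left :=
    isReduced_of_smooth_over_field ((Motives.baseChangeHom τ).obj (S.M.obj K)).hom
  haveI : IsSeparated ((Motives.baseChange ℚ ℂ).obj M).hom :=
    MorphismProperty.baseChange_obj (P := @IsSeparated) _ M ‹_›
  haveI : T2Space (ComplexPoints ((Motives.baseChange ℚ ℂ).obj M)) := ComplexPoints.t2Space_of_isSeparated _
  have hspec : specAut ℂ σL = specAut ℂ (σ.restrictScalars ℚ) := specAut_eq_of_forall_eq σL _ fun z => hσL z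
  have hTsnd : t ≫ pullback.snd M.hom (bcSpec ℚ ℂ) = pullback.snd (S.M.obj K).hom (bcSpec L ℂ) := by rw [ht]; exact Over.w ψ
  -- the conjugate morphism `gal σL⁻¹ ≫ ψ ≫ gal σ|_ℚ`, a morphism OVER `ℂ`
  have hw : (GaloisDescent.gal ℂ (S.M.obj K) σL⁻¹ ≫ t ≫ GaloisDescent.gal ℂ M (σ.restrictScalars ℚ)) ≫
      pullback.snd M.hom (bcSpec ℚ ℂ) = pullback.snd (S.M.obj K).hom (bcSpec L ℂ) := by
    rw [Category.assoc, Category.assoc, GaloisDescent.gal_snd, ← Category.assoc t, hTsnd,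
      GaloisDescent.gal_snd_assoc, inv_inv, hspec, AbelianVariety.specAut_comp_specAut_symm, Category.comp_id]
  let T' : (Motives.baseChangeHom τ).obj (S.M.obj K) ⟶ (Motives.baseChange ℚ ℂ).obj M :=
    Over.homMk (GaloisDescent.gal ℂ (S.M.obj K) σL⁻¹ ≫ t ≫ GaloisDescent.gal ℂ M (σ.restrictScalars ℚ)) hw
  have hT' : GaloisDescent.gal ℂ (S.M.obj K) σL⁻¹ ≫ t ≫ GaloisDescent.gal ℂ M (σ.restrictScalars ℚ) = T'.left := rfl
  have hT'T : T' = ψ := by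
    by_cases hne : ∃ v : Fin 2 → ℂ, v ∈ negCone (Jstar.map τ)
    · obtain ⟨v, hv⟩ := hne
      obtain ⟨w, hw0⟩ := exists_embedding_mem_negCone Jstar τ hv
      have hww : hermForm (cmConjRingHom L) Jstar w w ≠ 0 := hermForm_self_ne_zero_of_embedding_mem_negCone hw0
      refine (exists_finiteIdele_isArtinCorrespondent_algEquiv L τ σL).elim fun s hsL => ?_
      refine (exists_finiteIdele_isArtinCorrespondent_algEquiv L τ σL⁻¹).elim fun s' hsL' => ?_
      have hs : IsArtinCorrespondent L τ s σ.toRingEquiv := by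
        rw [← show σL.toRingEquiv = σ.toRingEquiv from RingEquiv.ext hσL]; exact hsL
      have hs' : IsArtinCorrespondent L τ s' σ⁻¹.toRingEquiv := by
        rw [← show σL⁻¹.toRingEquiv = σ⁻¹.toRingEquiv from RingEquiv.ext (inv_apply_eq_of_forall_eq σL σ hσL)]; exact hsL'
      refine (exists_isDiagTwistGS_recipFactor' L Jstar hJ hww s).elim fun d hd => ?_
      refine (exists_isDiagTwistGS_recipFactor' L Jstar hJ hww s').elim fun d' hd' => ?_
      have horbit : ∀ b : ↥(finAdelic (↥(maximalRealSubfield L)) L (IsCMField.complexConj L) 2 Jstar),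
          AlgPoints.map T' (e.symm (ShimuraSetGS.mk L Jstar τ K.1.1 (fun i => τ (w i)) hw0 b)) =
            AlgPoints.map ψ (e.symm (ShimuraSetGS.mk L Jstar τ K.1.1 (fun i => τ (w i)) hw0 b)) := by
        intro b
        rw [he]
        exact S.map_conj_eq_sliceComplex_of_recip K M f τE hf ψ hψ t ht σ σL hσL hw0 hs hs' hd hd' T' hT' b
      have hfun : (fun p => AlgPoints.map T' (e.symm p)) = fun p => AlgPoints.map ψ (e.symm p) :=
        ShimuraSetGS.eq_of_forall_mk_eq L Jstar τ K.1.1 hJ hdet hw0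
          ((AlgPoints.continuous_map T').comp e.symm.continuous)
          ((AlgPoints.continuous_map ψ).comp e.symm.continuous) horbit
      refine SchemeOver.hom_ext_of_forall_algPoints ℂ fun P => ?_
      have h := congrFun hfun (e P)
      simp only [Homeomorph.symm_apply_apply, AlgPoints.map_apply] at h
      exact h
    · -- no special point: `Sh_K(ℂ) = ∅`, so the complex fibre has no complex point
      refine SchemeOver.hom_ext_of_forall_algPoints ℂ fun P => ?_
      obtain ⟨v, hv, b, -⟩ := ShimuraSetGS.mk_surjective L Jstar τ K.1.1 (e P)
      exact absurd ⟨v, hv⟩ hne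
  have hconj : GaloisDescent.gal ℂ (S.M.obj K) σL⁻¹ ≫ t ≫ GaloisDescent.gal ℂ M (σ.restrictScalars ℚ) = t := by
    have h := congrArg (·.left) hT'T
    rwa [← hT', ← ht] at h
  have h := congrArg (GaloisDescent.gal ℂ (S.M.obj K) σL ≫ ·) hconj
  simp only [GaloisDescent.gal_comp_gal_symm_assoc] at h
  exact h.symm

omit t ht

/-! ### §4. Descent to the slice field: the HEAD -/

set_option maxHeartbeats 800000 in -- large adelic ∕ Shimura-set terms: instance-heavy statements (as ★ `UnitaryShimuraCurveHeckeDescent`)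
include hf in
/-- **Descent to the slice field `E ⊇ L` of a `ℂ`-morphism from the complex curve to a separated `ℚ`-scheme whose point map obeys CM
reciprocity for `Aut(ℂ∕τE E)`** ([Milne2005ShimuraVarieties] Prop. 13.1 + Lemma 13.5, the argument of Thm. 13.6–13.7 ∕ Rem. 13.8;
[Deligne1979ShimuraVarieties] 2.2.6): for the curve record system `S` over `L` along `τ`, `J⋆` `c`-hermitian and invertible, a small level `K`,
a number field `E ⊇ L` with `τE ∘ (L → E) = τ`, a `ℚ`-scheme `M` separated over `ℚ` and `f : Sh_K(ℂ) → M(ℂ)` with `σ|_ℚ • f [τw, aK] = f [τw, d·aK]`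
for all `σ ∈ Aut(ℂ∕τE E)` (Artin correspondent `s`, twists `d` by the reciprocity factor of `s`): if SOME `ℂ`-morphism `ψ : (M_K)_τ → M_ℂ` acts on
complex points as `f ∘ pts`, there is an `E`-morphism `ε : M_K ⊗_L E → M ⊗_ℚ E` «inducing `f`»: for every complex point `P` of `M_K ⊗_L E`
(along `τE`) and the complex point `P♭ = P ≫ pr₁` of `M_K` (along `τ`), `ε(P) ≫ pr₁ = f (pts P♭)`.  (§3 ⇒ `Aut(ℂ∕τE E)`-equivariance of
`gX ≫ ψ ≫ gM⁻¹` along the transitivity isomorphisms ★ `Motives.exists_iso_baseChangeHom_baseChange`, descent by ★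
`GaloisDescent.existsUnique_map_eq_complex`, point formula on first projections.)  `stub_E5` of the E-line of crux hLiu418, the chart՚s
`(𝓜.M, f, f_recip)` by value. [cite: Milne2005ShimuraVarieties, Prop. 13.1 p. 117; Thm. 13.7 and Rem. 13.8 p. 119; Def. 12.8 (62) p. 114]
[cite: Deligne1979ShimuraVarieties, 2.2.6 and Cor. 2.7.21] [cite: GortzWedhorn2020, Prop. 4.16 and §(4.7)] -/
theorem RecordSystemGS.exists_sliceDescent_of_complex [IsSeparated M.hom] (hτ : τE.comp (algebraMap L E) = τ)
    (hJ : (Jstar.map (IsCMField.complexConj L))ᵀ = Jstar) (hJu : IsUnit Jstar)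
    (hC : letI : Algebra L ℂ := τ.toAlgebra
      ∃ ψ : (Motives.baseChangeHom τ).obj (S.M.obj K) ⟶ (Motives.baseChange ℚ ℂ).obj M,
        ∀ P : ComplexPoints (S.M.obj K),
          (AlgPoints.map ψ (AlgPoints.baseChangeEquiv τ (S.M.obj K) P)).left ≫
              Motives.baseChangeHomFst (algebraMap ℚ ℂ) M =
            (f (S.pts K P)).left) :
    letI : Algebra E ℂ := τE.toAlgebra
    ∃ ε : (Motives.baseChange L E).obj (S.M.obj K) ⟶ (Motives.baseChange ℚ E).obj M,
      ∀ (P : ComplexPoints ((Motives.baseChange L E).obj (S.M.obj K)))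
        (Pflat : letI : Algebra L ℂ := τ.toAlgebra; ComplexPoints (S.M.obj K)),
        Pflat.left = P.left ≫ pullback.fst (S.M.obj K).hom (bcSpec L E) →
        (AlgPoints.map ε P).left ≫ pullback.fst M.hom (bcSpec ℚ E) =
          (letI : Algebra L ℂ := τ.toAlgebra; (f (S.pts K Pflat)).left) := by
  letI iE : Algebra E ℂ := τE.toAlgebra; letI iL : Algebra L ℂ := τ.toAlgebra
  haveI : IsScalarTower L E ℂ := IsScalarTower.of_algebraMap_eq fun x => (RingHom.congr_fun hτ x).symm
  obtain ⟨ψ, hψ⟩ := hC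
  have hdet : IsUnit Jstar.det := (Matrix.isUnit_iff_isUnit_det Jstar).mp hJu
  haveI : SmoothOfRelativeDimension 1 ((Motives.baseChangeHom τ).obj (S.M.obj K)).hom := S.smooth_complexFibre K
  haveI : Smooth ((Motives.baseChangeHom τ).obj (S.M.obj K)).hom := SmoothOfRelativeDimension.smooth 1 _
  haveI hXred : IsReduced ((Motives.baseChangeHom τ).obj (S.M.obj K)).left :=
    isReduced_of_smooth_over_field ((Motives.baseChangeHom τ).obj (S.M.obj K)).hom
  haveI : IsReduced (GaloisDescent.bc ℂ (S.M.obj K)) := hXred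
  obtain ⟨eK, heK⟩ := S.exists_homeomorph_complexFibre K
  set X : SchemeOver E := (Motives.baseChange L E).obj (S.M.obj K)
  set Y : SchemeOver E := (Motives.baseChange ℚ E).obj M
  obtain ⟨gX, hgX1, hgX2, -⟩ := Motives.exists_iso_baseChangeHom_baseChange hτ (S.M.obj K)
  have hτℚ : τE.comp (algebraMap ℚ E) = algebraMap ℚ ℂ := Subsingleton.elim _ _
  obtain ⟨gM, hgM1, hgM2, -⟩ := Motives.exists_iso_baseChangeHom_baseChange (τ := algebraMap ℚ ℂ) hτℚ M
  obtain ⟨tX, htX⟩ : ∃ tX : GaloisDescent.bc ℂ X ⟶ GaloisDescent.bc ℂ (S.M.obj K), tX = gX.hom.left := ⟨_, rfl⟩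
  obtain ⟨tM, htM⟩ : ∃ tM : GaloisDescent.bc ℂ Y ⟶ GaloisDescent.bc ℂ M, tM = gM.hom.left := ⟨_, rfl⟩
  obtain ⟨tM', htM'⟩ : ∃ tM' : GaloisDescent.bc ℂ M ⟶ GaloisDescent.bc ℂ Y, tM' = gM.inv.left := ⟨_, rfl⟩
  obtain ⟨t, ht⟩ : ∃ t : GaloisDescent.bc ℂ (S.M.obj K) ⟶ GaloisDescent.bc ℂ M, t = ψ.left := ⟨_, rfl⟩
  have hMM' : tM ≫ tM' = 𝟙 _ := by rw [htM, htM']; exact congrArg CommaMorphism.left gM.hom_inv_id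
  have hM'M : tM' ≫ tM = 𝟙 _ := by rw [htM, htM']; exact congrArg CommaMorphism.left gM.inv_hom_id
  have hgX1' : tX ≫ pullback.fst (S.M.obj K).hom (bcSpec L ℂ) =
      pullback.fst X.hom (bcSpec E ℂ) ≫ pullback.fst (S.M.obj K).hom (bcSpec L E) := by
    rw [htX]; exact hgX1
  have hgX2' : tX ≫ pullback.snd (S.M.obj K).hom (bcSpec L ℂ) = pullback.snd X.hom (bcSpec E ℂ) := by rw [htX]; exact hgX2
  have hgM1' : tM ≫ pullback.fst M.hom (bcSpec ℚ ℂ) =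
      pullback.fst Y.hom (bcSpec E ℂ) ≫ pullback.fst M.hom (bcSpec ℚ E) := by
    rw [htM]; exact hgM1
  have hgM2' : tM ≫ pullback.snd M.hom (bcSpec ℚ ℂ) = pullback.snd Y.hom (bcSpec E ℂ) := by rw [htM]; exact hgM2
  let g : (bcFunctor E ℂ).obj X ⟶ (bcFunctor E ℂ).obj Y := gX.hom ≫ ψ ≫ gM.inv
  have hg : g.left = tX ≫ t ≫ tM' := by rw [htX, ht, htM']; rfl
  have hequiv : ∀ σ : ℂ ≃ₐ[E] ℂ, GaloisDescent.gal ℂ X σ ≫ g.left = g.left ≫ GaloisDescent.gal ℂ Y σ := by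
    intro σ
    have hspecL : specAut ℂ (σ.restrictScalars L)⁻¹ = specAut ℂ σ⁻¹ := specAut_eq_of_forall_eq _ _ (inv_apply_eq_of_forall_eq _ _ fun _ => rfl)
    have hspecQ : specAut ℂ (σ.restrictScalars ℚ)⁻¹ = specAut ℂ σ⁻¹ := specAut_eq_of_forall_eq _ _ (inv_apply_eq_of_forall_eq _ _ fun _ => rfl)
    have TX : GaloisDescent.gal ℂ X σ ≫ tX = tX ≫ GaloisDescent.gal ℂ (S.M.obj K) (σ.restrictScalars L) := by
      apply pullback.hom_ext
      · rw [Category.assoc, Category.assoc, GaloisDescent.gal_fst, hgX1', GaloisDescent.gal_fst_assoc]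
      · rw [Category.assoc, Category.assoc, GaloisDescent.gal_snd, hgX2', ← Category.assoc, hgX2',
          GaloisDescent.gal_snd, hspecL]
    have TM : GaloisDescent.gal ℂ Y σ ≫ tM = tM ≫ GaloisDescent.gal ℂ M (σ.restrictScalars ℚ) := by
      apply pullback.hom_ext
      · rw [Category.assoc, Category.assoc, GaloisDescent.gal_fst, hgM1', GaloisDescent.gal_fst_assoc]
      · rw [Category.assoc, Category.assoc, GaloisDescent.gal_snd, hgM2', ← Category.assoc, hgM2',
          GaloisDescent.gal_snd, hspecQ]
    have TM' : GaloisDescent.gal ℂ M (σ.restrictScalars ℚ) ≫ tM' = tM' ≫ GaloisDescent.gal ℂ Y σ := by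
      have h := congrArg (fun u => tM' ≫ u ≫ tM') TM
      simp only [Category.assoc, hMM', Category.comp_id] at h
      rw [← Category.assoc, hM'M, Category.id_comp] at h
      exact h.symm
    have hψσ := S.gal_comp_sliceComplex K M f τE hf ψ hψ t ht hJ hdet σ (σ.restrictScalars L) (fun _ => rfl) eK heK
    have key : GaloisDescent.gal ℂ X σ ≫ tX ≫ t ≫ tM' = (tX ≫ t ≫ tM') ≫ GaloisDescent.gal ℂ Y σ := by
      rw [reassoc_of% TX, reassoc_of% hψσ, TM']
      simp only [Category.assoc]
    rw [hg]; exact key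
  -- DESCENT (Prop. 13.1)
  haveI : IsIso tX := ⟨⟨gX.inv.left, by rw [htX]; exact congrArg CommaMorphism.left gX.hom_inv_id,
    by rw [htX]; exact congrArg CommaMorphism.left gX.inv_hom_id⟩⟩
  haveI : IsReduced (GaloisDescent.bc ℂ X) := isReduced_of_isOpenImmersion tX
  haveI : IsSeparated Y.hom := MorphismProperty.baseChange_obj (P := @IsSeparated) _ M ‹_›
  have hE : #E ≤ ℵ₀ := (Algebra.IsAlgebraic.cardinalMk_le_max ℚ E).trans (by rw [Cardinal.mkRat, max_self])
  refine (GaloisDescent.existsUnique_map_eq_complex (K := E) (X := X) (Y := Y) hE g hequiv).exists.elim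
    fun ε hε => ⟨ε, fun P Pflat hP => ?_⟩
  -- POINTS: `ε(P) ≫ pr₁ = f (pts P♭)`
  have hfl : ((bcFunctor E ℂ).map ε).left =
      pullback.lift (pullback.fst X.hom (bcSpec E ℂ) ≫ ε.left) (pullback.snd X.hom (bcSpec E ℂ))
        (by rw [Category.assoc, Over.w ε]; exact pullback.condition) :=
    Over.pullback_map_left _ _
  have hp : pullback.lift P.toSpecHom (𝟙 (Spec (.of ℂ))) (toSpecHom_comp_hom_eq (τ := τE) X P) ≫ tX =
      pullback.lift Pflat.toSpecHom (𝟙 (Spec (.of ℂ))) (toSpecHom_comp_hom_eq (τ := τ) (S.M.obj K) Pflat) := by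
    apply pullback.hom_ext
    · rw [Category.assoc, hgX1', pullback.lift_fst_assoc, pullback.lift_fst]
      exact hP.symm
    · rw [Category.assoc, hgX2', pullback.lift_snd, pullback.lift_snd]
  have hM'fst : tM' ≫ pullback.fst Y.hom (bcSpec E ℂ) ≫ pullback.fst M.hom (bcSpec ℚ E) = pullback.fst M.hom (bcSpec ℚ ℂ) := by
    rw [← hgM1', ← Category.assoc, hM'M, Category.id_comp]
  have hflat : pullback.lift Pflat.toSpecHom (𝟙 (Spec (.of ℂ))) (toSpecHom_comp_hom_eq (τ := τ) (S.M.obj K) Pflat) ≫ t ≫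
      pullback.fst M.hom (bcSpec ℚ ℂ) = (f (S.pts K Pflat)).left := by
    rw [← Category.assoc, S.lift_comp_sliceComplex_left K M f ψ hψ t ht Pflat, pullback.lift_fst]
  obtain ⟨tε, htε⟩ : ∃ tε : GaloisDescent.bc ℂ X ⟶ GaloisDescent.bc ℂ Y, tε = ((bcFunctor E ℂ).map ε).left := ⟨_, rfl⟩
  have htε' : tε = tX ≫ t ≫ tM' := by rw [htε, hε, hg]
  have hεfst : tε ≫ pullback.fst Y.hom (bcSpec E ℂ) = pullback.fst X.hom (bcSpec E ℂ) ≫ ε.left := by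
    rw [htε, hfl]; exact pullback.lift_fst _ _ _
  -- assemble: `P ≫ ε ≫ pr₁ = (P, 1) ≫ g ≫ pr₁ ≫ pr₁ = (P♭, 1) ≫ ψ ≫ pr₁ = f (pts P♭)`
  rw [← hp, Category.assoc, ← hM'fst, ← reassoc_of% htε', reassoc_of% hεfst, pullback.lift_fst_assoc] at hflat
  rw [AlgPoints.map_apply, Over.comp_left, Category.assoc]
  exact hflat

end SliceDescent

end Literature.AlgebraicGeometry.ShimuraVarieties.UnitaryCanonicalModel

end
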